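import Literature.MathematicalPhysics.QuantumFieldTheory.Balaban1983to89.B9Thm37GluePU

/-!
# `Balaban1983to89.B9Thm37GlueChart` — the GEOMETRY binders of the (3.42) ⇒ (3.89) glue in the j = 0 chart
# reading of the torus model: located supports, cover multiplicities, volume products — print's «O(M⁻¹)» of
# (3.89)/(2.44) as an explicit number (sibling leaf of `B9Thm37GluePU`; own lineage pv21; imports
# `B9Thm37GluePU` only; modifies nothing, consumes the b05 lineage's `B5TorusCover` counting BY NAME)

References (bib keys; the tags below cite only these):
* [B9] = `Balaban1985BackgroundPropagators` — T. Bałaban, *Propagators for lattice gauge theories in a background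
  field*, Commun. Math. Phys. 99 (1985) 389–434 (cell source #5, renders `1985-cmp99-background-propagators-pNNN-x2.png`).
* [4] = `Balaban1984PropagatorsII` — T. Bałaban, *Propagators and renormalization transformations for lattice gauge
  theories. II*, Commun. Math. Phys. 96 (1984) 223–250.
* [3] = `Balaban1984PropagatorsI` — T. Bałaban, *Propagators and renormalization transformations for lattice gauge
  theories. I*, Commun. Math. Phys. 95 (1984) 17–40.

THE PRINTED LOCI (all certified in the headers of the modules this file imports; nothing new is quoted here).
[B9] p. 409 (3.89) (header of `B9Thm37GlueSz`): *"Using the inequalities (3.42) for G′_□, we get the bound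
|(K(h_□)G′_□h_□λ)(x)| ≦ O(M^{−1})e^{−δ₀(L^jη)^{−1}|y−y′|}|λ| (3.89) for x ∈ Δ(y), supp λ ⊂ Δ(y′), y, y′ ∈ □ ∈ 𝒟_j.
It is exactly the bound (2.44) of [4], rescaled to η-scale."*; [4] p. 230 (2.44) (same header): *"… |(K(h_□)G′(□)h_□λ)(x)|
≦ O(M^{−1})e^{−δ₀|x−y|}|λ| (2.44) … The distance in the above inequality is measured on L^{−j}-scale."*; [B9] p. 397
(header of `B9`): *"Here y, y′ ∈ 𝔅 = ⋃_{j=0}^k Λ_j. Let us recall that if y ∈ Λ_j, then Δ(y) = B^j(y), and Δ̃(y) is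
a cube of the size 2L^jη on the lattice T_η with center at the point y"* and (3.41) (the length L^jη attached to
y ∈ Λ_j, `B9.Geometry.len`); [B9] p. 408 and [4] p. 229 (2.36), [3] p. 36 (1.118) (header of `B9Thm37GluePU`): the cube
family 𝒟 and the partition of unity Σ_□ h_□² = 1; [3] p. 36 (header of `B5TorusCover`): *"cubes □_z of size 2M₀ and
with a center at the point z ∈ T^{(k+m₀)}_{M₀}. These cubes cover the lattice T_η"*; [4] p. 224 (2.4) and p. 231
(2.46) (header of `B6Geometry`): *"T = ⋃_{j=0}^k B^j(Λ_j), where B⁰(Λ₀) = Λ₀"* and the contour distance d(y, y′).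

THE POINT (value = kernel-checked bookkeeping, NOT summit progress).  `B9Thm37GluePU.thm37_entry4_torus` discharged
the eight PARTITION-OF-UNITY binders of the pv21 entry theorems in the nearest-neighbour torus bond model and left
the GEOMETRY of print's silent counting as hypotheses: the block maps `blk`, `blkY` into the coarse geometry `g`,
the located supports `S_□ ⊆ S′_□` (`hS`, `hsupp`), their cover multiplicities `N`, `N′` (`hcnt`, `hcnt′`), the
ρ-adjacency of bond blocks (`hadj`) and the volume products `v₁ ≥ θ_□·Σ_{y ∈ S′_□, d(a,y) ≤ ρ} L^{j}η`,
`v₂ ≥ θ_{2,□}·(L^{j}η)²` (`hV₁`, `hV₂`) — the numbers print abbreviates to «O(M^{−1})» in (3.89)/(2.44).  THIS FILE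
discharges all seven in the j = 0 CHART READING (MODEL, `DIVERGENCE.md`): the fine torus `UT N` is read into the
coarse geometry by an injective chart `e : UT N → g.Site` which is an isometry for the SUP-metric `dist` = `tdist`
of the b05 carrier `UT N` in lattice units (`g.dist (e x) (e y) = dist x y`; print's d(y, y′) of [4] (2.46) is the
ℓ¹ contour length on L^{−j}-scale, which dominates the sup-metric — a MODEL choice; the glue theorems are
metric-agnostic, `htri`/`hrefl`/`hdnn` staying hypotheses on `g.dist`) with constant length `g.len (e x) = ℓ` on its
image (print's L^{j}η at j = 0, i.e. ℓ = η; by [4] (2.4) «B⁰(Λ₀) = Λ₀» the block Δ(y) = B⁰(y) of a scale-0 site is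
the single point y); `blk := e ∘ fst`, `blkY := e ∘ bsrc ∘ fst`;
`S_z := e''{x : dist(x, z) < M₀}` ⊆ `S′_z := e''{x : dist(x, z) < M₀ + 1}` (§1).  Then (§2): `hS` from the support of
h_z in the open cube (`hSU_eq_zero_of_far`); `hsupp` from `near_ctr_of_dh_ne`; `hcnt` with N = 5^d and `hcnt′` with
N′ = 7^d from the b05 cover multiplicity `B5TorusCover.hnu_holds` (c̄ = 1, 2); `hadj` for every ρ ≥ 1 (bonds have
length 1, `dist_up_le`); `hV₁` with v₁ = θ·(2⌊ρ⌋+1)^d·ℓ from the torus ball count `B5TorusCover.ballCard_le_real`;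
`hV₂` with v₂ = θ₂·ℓ².  §3: in print's normalisation |c₀|·ℓ = η^{−1}·η = 1 these products ARE the explicit numbers
v₁ = 4d(2⌊ρ⌋+1)^d/M₀ and v₂ = 52d/M₀² — print's «O(M^{−1})», «O(M^{−2})» with the cube size M ↔ M₀ (`v₁_explicit`,
`v₂_explicit`).  §4: `thm37_entry4_chart` = `thm37_entry4_torus` with the seven geometry binders discharged; what
remains hypothesis is exactly: the orthogonality `hRm` of the rotation matrices, the numeric ranges, the distance
axioms of the abstract `g` off the chart (`htri`, `hrefl`, `hdnn`, `hlen`), Lemma 2.1 of [4] (`h261`, `h263`), the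
located smallness `hsmall` (now with explicit v₁, v₂, N′), the Q-data (`hKQ`, `hlocQ`, `hrowQ`, `hQ` — cf.
`B9Thm37GlueQ`), Corollary 3.6 for the G′_□ (`h342_*`), `hloc`, `hinv`.  §5: non-vacuity (the identity chart).

NOT ASSERTED.  Everything listed as remaining; the multi-scale cube family 𝒟 (ONE scale, j = 0); that print's Δ(y)
are points (they are blocks B^j(y) for j ≥ 1 — the chart reading is the j = 0 member only); that print's distance is
the sup-metric (it is the ℓ¹ contour distance (2.46) of [4]); the b05 profile (D-b05g5.4); the constants 5^d, 7^d,
4d(2⌊ρ⌋+1)^d, 52d are the cell's unoptimised worst cases for print's O(1) (print counts 2^d cubes through a point).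
No new printed locus is read by this module ([4] (2.4), (2.46) are certified in the header of `B6Geometry`).
-/

namespace Literature.MathematicalPhysics.QuantumFieldTheory.Balaban1983to89.B9Thm37GlueChart

open Finset B6RandomWalk B6RandomWalkHom B9Thm37Sum B9Thm34Ext B9Thm37Glue B9Thm37GlueT B9Thm37GlueSt B9Thm37GlueSz
open B9Thm37GluePU
open B5TorusCover (UT Ctr ctr ctrU hnu_holds ballCard_le_real)
open B5SmoothPartition (hSU)
open B5Leibniz121 (up dn dist_up_le)

noncomputable section

variable {d : ℕ} {N : Fin d → ℕ} {g : B9.Geometry}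

/-! ## §1  The chart, the block maps and the located supports -/

section Chart

variable {Cp : Type}

/-- MODEL. Block map of the j = 0 chart reading: the colour component is forgotten, the point is read into `g`
through the chart `e` (print: x ∈ Δ(y) = B^j(y); at j = 0 the block of x is x). [cite: Balaban1985BackgroundPropagators, (3.39)–(3.41) pp.396–397] -/
def cblk (e : UT N → g.Site) (p : UT N × Cp) : g.Site := e p.1

/-- MODEL. Block map for bond-indexed vectors: a bond is located at (the block of) its source point. [cite: Balaban1985BackgroundPropagators, (3.39)–(3.41) pp.396–397 + (3.3) p.391] -/
def cblkY (e : UT N → g.Site) (q : (UT N × Fin d) × Cp) : g.Site := e (bsrc q.1)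

/-- Unfolding of `cblk`. [folklore] -/
@[simp] theorem cblk_apply (e : UT N → g.Site) (x : UT N) (i : Cp) : cblk e (x, i) = e x := rfl

/-- Unfolding of `cblkY`. [folklore] -/
@[simp] theorem cblkY_apply (e : UT N → g.Site) (b : UT N × Fin d) (k : Cp) : cblkY e (b, k) = e b.1 := rfl

variable [∀ i, NeZero (N i)] [DecidableEq g.Site]

/-- MODEL. The located support sets: the chart image of the open torus ball of radius `r` round the centre `z`
(`r = M₀`: the open cube □_z carrying h_z; `r = M₀ + 1`: its 1-neighbourhood, carrying ∂h_z and Δh_z). [cite: Balaban1984PropagatorsI, (1.118) p.36] -/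
def Sball (e : UT N → g.Site) (M₀ : ℕ) (r : ℝ) (z : Ctr N M₀) : Finset g.Site :=
  (Finset.univ.filter fun x : UT N => dist x (ctrU N M₀ z) < r).image e

/-- Membership of a chart point in `Sball`. [folklore] -/
theorem mem_Sball_iff {e : UT N → g.Site} (he : Function.Injective e) {M₀ : ℕ} {r : ℝ} {z : Ctr N M₀} {x : UT N} :
    e x ∈ Sball e M₀ r z ↔ dist x (ctrU N M₀ z) < r := by
  unfold Sball
  constructor
  · intro h
    obtain ⟨y, hy, hyx⟩ := Finset.mem_image.mp h
    rw [← he hyx]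
    exact (Finset.mem_filter.mp hy).2
  · intro h
    exact Finset.mem_image.mpr ⟨x, Finset.mem_filter.mpr ⟨Finset.mem_univ _, h⟩, rfl⟩

/-- Every point of `Sball` is a chart point of the ball. [folklore] -/
theorem exists_of_mem_Sball {e : UT N → g.Site} {M₀ : ℕ} {r : ℝ} {z : Ctr N M₀} {a : g.Site}
    (ha : a ∈ Sball e M₀ r z) : ∃ x : UT N, e x = a ∧ dist x (ctrU N M₀ z) < r := by
  obtain ⟨x, hx, hxa⟩ := Finset.mem_image.mp ha
  exact ⟨x, hxa, (Finset.mem_filter.mp hx).2⟩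

/-- Off the chart image no located support set contains the point. [folklore] -/
theorem not_mem_Sball_of_not_range {e : UT N → g.Site} {M₀ : ℕ} {r : ℝ} {z : Ctr N M₀} {a : g.Site}
    (ha : a ∉ Set.range e) : a ∉ Sball e M₀ r z := fun h => by
  obtain ⟨x, hxa, -⟩ := exists_of_mem_Sball h
  exact ha ⟨x, hxa⟩

end Chart

/-! ## §2  The seven geometry binders discharged -/

section Binders

variable {Cp : Type} [∀ i, NeZero (N i)] [DecidableEq g.Site]

/-- **The binder `hS`**: h_z(x) ≠ 0 forces x into the open cube □_z, hence its block into `S_z`. [cite: Balaban1984PropagatorsI, (1.118) p.36] -/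
theorem hS_chart {e : UT N → g.Site} (he : Function.Injective e) {M₀ : ℕ} (hM : 1 ≤ M₀) :
    ∀ (z : Ctr N M₀) (p : UT N × Cp), hSU N M₀ z p.1 ≠ 0 → cblk e p ∈ Sball e M₀ M₀ z := by
  intro z p hp
  rw [cblk, mem_Sball_iff he]
  by_contra hfar
  exact hp (hSU_eq_zero_of_far hM (not_lt.mp hfar))

/-- The torus ball count in the carrier `UT N`: `#{w : dist(x, w) ≤ r} ≤ (2⌊r⌋ + 1)^d`. [folklore] -/
theorem ballCard_UT_le (x : UT N) {r : ℝ} (hr : 0 ≤ r) :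
    ((Finset.univ.filter fun w : UT N => dist x w ≤ r).card : ℝ) ≤ (2 * ⌊r⌋₊ + 1 : ℝ) ^ d :=
  ballCard_le_real (B5TorusCover.UT.one_le N) (B5TorusCover.UT.toSite N x) hr

/-- Counting the located supports through a point: `Σ_z 1_{a ∈ Sball r z} ≤ (2c̄ + 3)^d` whenever `r ≤ c̄M₀` — the
b05 cover multiplicity `hnu_holds` read through the chart. [cite: Balaban1984PropagatorsI, p.36] -/
theorem cnt_Sball_le {e : UT N → g.Site} (he : Function.Injective e) {M₀ : ℕ} (hM : 1 ≤ M₀) {r cbar : ℝ}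
    (hc : 0 ≤ cbar) (hr : r ≤ cbar * M₀) (a : g.Site) :
    (∑ z : Ctr N M₀, if a ∈ Sball e M₀ r z then (1 : ℝ) else 0) ≤ (2 * cbar + 3) ^ d := by
  by_cases ha : a ∈ Set.range e
  · obtain ⟨x, rfl⟩ := ha
    have hrw : (∑ z : Ctr N M₀, if e x ∈ Sball e M₀ r z then (1 : ℝ) else 0) =
        ((Finset.univ.filter fun z : Ctr N M₀ => dist x (ctrU N M₀ z) < r).card : ℝ) := by
      rw [Finset.natCast_card_filter]
      exact Finset.sum_congr rfl fun z _ => if_congr (mem_Sball_iff he) rfl rfl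
    rw [hrw]
    calc ((Finset.univ.filter fun z : Ctr N M₀ => dist x (ctrU N M₀ z) < r).card : ℝ)
        ≤ ((Finset.univ.filter fun z : Ctr N M₀ => dist x (ctrU N M₀ z) ≤ cbar * M₀).card : ℝ) := by
          exact_mod_cast Finset.card_le_card fun z hz => by
            rw [Finset.mem_filter] at hz ⊢
            exact ⟨hz.1, (hz.2.trans_le hr).le⟩
      _ ≤ (2 * cbar + 3) ^ d := hnu_holds N hM hc x
  · have h0 : (∑ z : Ctr N M₀, if a ∈ Sball e M₀ r z then (1 : ℝ) else 0) = 0 :=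
      Finset.sum_eq_zero fun z _ => if_neg (not_mem_Sball_of_not_range ha)
    rw [h0]
    positivity

/-- **The binder `hcnt`** with `N := 5^d`: at most 5^d open cubes □_z of the 2M₀-cover contain a given point
(c̄ = 1 in `hnu_holds`; print: 2^d). [cite: Balaban1984PropagatorsI, p.36] -/
theorem hcnt_chart {e : UT N → g.Site} (he : Function.Injective e) {M₀ : ℕ} (hM : 1 ≤ M₀) :
    ∀ a : g.Site, (∑ z : Ctr N M₀, if a ∈ Sball e M₀ M₀ z then (1 : ℝ) else 0) ≤ (5 : ℝ) ^ d := fun a =>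
  calc (∑ z : Ctr N M₀, if a ∈ Sball e M₀ M₀ z then (1 : ℝ) else 0) ≤ (2 * 1 + 3) ^ d :=
        cnt_Sball_le (r := (M₀ : ℝ)) he hM zero_le_one (by rw [one_mul]) a
    _ = (5 : ℝ) ^ d := by norm_num

/-- **The binder `hcnt′`** with `N′ := 7^d`: at most 7^d of the 1-neighbourhoods of the cubes contain a given
point (M₀ + 1 ≤ 2M₀, c̄ = 2 in `hnu_holds`). [cite: Balaban1984PropagatorsI, p.36] -/
theorem hcnt'_chart {e : UT N → g.Site} (he : Function.Injective e) {M₀ : ℕ} (hM : 1 ≤ M₀) :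
    ∀ a : g.Site, (∑ z : Ctr N M₀, if a ∈ Sball e M₀ (M₀ + 1) z then (1 : ℝ) else 0) ≤ (7 : ℝ) ^ d := fun a => by
  have hM' : (1 : ℝ) ≤ M₀ := by exact_mod_cast hM
  calc (∑ z : Ctr N M₀, if a ∈ Sball e M₀ (M₀ + 1) z then (1 : ℝ) else 0) ≤ (2 * 2 + 3) ^ d :=
        cnt_Sball_le (r := (M₀ + 1 : ℝ)) he hM zero_le_two (by linarith) a
    _ = (7 : ℝ) ^ d := by norm_num

/-- **The binder `hsupp`**: a bond on which h_z jumps has both endpoints (and hence every block attached to it)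
in the 1-neighbourhood `S′_z` (`near_ctr_of_dh_ne`). [cite: Balaban1984PropagatorsI, (1.118) p.36; Balaban1985BackgroundPropagators, (3.50) p.400] -/
theorem hsupp_chart {e : UT N → g.Site} (he : Function.Injective e) {M₀ : ℕ} (hM : 1 ≤ M₀) :
    ∀ (z : Ctr N M₀) (b : UT N × Fin d), hSU N M₀ z (btgt b) ≠ hSU N M₀ z (bsrc b) →
      (∀ j : Cp, cblk e (bsrc b, j) ∈ Sball e M₀ (M₀ + 1) z ∧ cblk e (btgt b, j) ∈ Sball e M₀ (M₀ + 1) z) ∧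
        ∀ k : Cp, cblkY e (b, k) ∈ Sball e M₀ (M₀ + 1) z := by
  intro z b hne
  obtain ⟨hx, hu⟩ := near_ctr_of_dh_ne hM z b.1 b.2 (by simpa [bsrc, btgt] using hne)
  refine ⟨fun j => ⟨?_, ?_⟩, fun k => ?_⟩
  · simpa [cblk, bsrc, mem_Sball_iff he] using hx
  · simpa [cblk, btgt, mem_Sball_iff he] using hu
  · simpa [cblkY, bsrc, mem_Sball_iff he] using hx

omit [DecidableEq g.Site] in
/-- **The binder `hadj`** for every ρ ≥ 1: the block of a bond (its source point) is within distance 1 of the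
blocks of both endpoints — nearest-neighbour bonds have length 1 and the chart is an isometry. [cite: Balaban1985BackgroundPropagators, (3.3) p.391 + (3.41) p.397] -/
theorem hadj_chart {e : UT N → g.Site} (hiso : ∀ x y : UT N, g.dist (e x) (e y) = dist x y) {ρ : ℝ} (hρ : 1 ≤ ρ) :
    ∀ (b : UT N × Fin d) (i k : Cp),
      g.dist (cblk e (bsrc b, i)) (cblkY e (b, k)) ≤ ρ ∧ g.dist (cblk e (btgt b, i)) (cblkY e (b, k)) ≤ ρ ∧
        g.dist (cblkY e (b, k)) (cblk e (bsrc b, i)) ≤ ρ ∧ g.dist (cblkY e (b, k)) (cblk e (btgt b, i)) ≤ ρ := by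
  intro b i k
  have h0 : g.dist (e b.1) (e b.1) ≤ ρ := by rw [hiso, dist_self]; linarith
  have h1 : g.dist (e (up b.1 b.2)) (e b.1) ≤ ρ := by
    rw [hiso, dist_comm]; exact (dist_up_le b.1 b.2).trans hρ
  have h2 : g.dist (e b.1) (e (up b.1 b.2)) ≤ ρ := by
    rw [hiso]; exact (dist_up_le b.1 b.2).trans hρ
  simp only [cblk_apply, cblkY_apply, bsrc, btgt]
  exact ⟨h0, h1, h0, h2⟩

/-- On a located support set the length is the chart constant ℓ. [folklore] -/
theorem len_eq_of_mem_Sball {e : UT N → g.Site} {ℓ : ℝ} (hlenE : ∀ x, g.len (e x) = ℓ) {M₀ : ℕ} {r : ℝ}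
    {z : Ctr N M₀} {a : g.Site} (ha : a ∈ Sball e M₀ r z) : g.len a = ℓ := by
  obtain ⟨x, rfl, -⟩ := exists_of_mem_Sball ha
  exact hlenE x

/-- The local volume of a located support set: `Σ_{y ∈ S′_z, d(a,y) ≤ ρ} len y ≤ (2⌊ρ⌋+1)^d·ℓ` for a = e x on the
chart — the torus ball count times the constant length. [cite: Balaban1985BackgroundPropagators, (3.41) p.397; Balaban1984PropagatorsII, (2.44) p.230] -/
theorem localVol_le {e : UT N → g.Site} (hiso : ∀ x y : UT N, g.dist (e x) (e y) = dist x y)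
    {ℓ : ℝ} (hℓ : 0 ≤ ℓ) (hlenE : ∀ x, g.len (e x) = ℓ) {M₀ : ℕ} {r ρ : ℝ} (hρ : 0 ≤ ρ) (z : Ctr N M₀) (x : UT N) :
    ∑ y ∈ (Sball e M₀ r z).filter (fun y => g.dist (e x) y ≤ ρ), g.len y ≤ (2 * ⌊ρ⌋₊ + 1 : ℝ) ^ d * ℓ := by
  set T := (Sball e M₀ r z).filter (fun y => g.dist (e x) y ≤ ρ) with hT
  have hlenT : ∀ y ∈ T, g.len y = ℓ := fun y hy =>
    len_eq_of_mem_Sball hlenE (Finset.mem_filter.mp hy).1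
  have hsub : T ⊆ (Finset.univ.filter fun w : UT N => dist x w ≤ ρ).image e := by
    intro y hy
    obtain ⟨hyS, hyd⟩ := Finset.mem_filter.mp hy
    obtain ⟨w, rfl, -⟩ := exists_of_mem_Sball hyS
    rw [hiso] at hyd
    exact Finset.mem_image.mpr ⟨w, Finset.mem_filter.mpr ⟨Finset.mem_univ _, hyd⟩, rfl⟩
  have hcard : (T.card : ℝ) ≤ (2 * ⌊ρ⌋₊ + 1 : ℝ) ^ d :=
    calc (T.card : ℝ) ≤ (((Finset.univ.filter fun w : UT N => dist x w ≤ ρ).image e).card : ℝ) := by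
          exact_mod_cast Finset.card_le_card hsub
      _ ≤ ((Finset.univ.filter fun w : UT N => dist x w ≤ ρ).card : ℝ) := by
          exact_mod_cast Finset.card_image_le
      _ ≤ (2 * ⌊ρ⌋₊ + 1 : ℝ) ^ d := ballCard_UT_le x hρ
  calc ∑ y ∈ T, g.len y = ∑ _y ∈ T, ℓ := Finset.sum_congr rfl hlenT
    _ = (T.card : ℝ) * ℓ := by rw [Finset.sum_const, nsmul_eq_mul]
    _ ≤ (2 * ⌊ρ⌋₊ + 1 : ℝ) ^ d * ℓ := mul_le_mul_of_nonneg_right hcard hℓ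

/-- **The binder `hV₁`** with `v₁ := θ·(2⌊ρ⌋+1)^d·ℓ`, θ = |c₀|·4d/M₀ (the size discharged in `B9Thm37GluePU`):
the ∂h_□-size times the local volume — print's «O(M^{−1})» of (3.89)/(2.44) before normalisation. [cite: Balaban1985BackgroundPropagators, (3.89) p.409; Balaban1984PropagatorsII, (2.44) p.230] -/
theorem hV₁_chart {e : UT N → g.Site} (hiso : ∀ x y : UT N, g.dist (e x) (e y) = dist x y)
    {ℓ : ℝ} (hℓ : 0 ≤ ℓ) (hlenE : ∀ x, g.len (e x) = ℓ) {M₀ : ℕ} {ρ : ℝ} (hρ : 0 ≤ ρ) (c₀ : ℝ) :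
    ∀ (z : Ctr N M₀) (a : g.Site), a ∈ Sball e M₀ (M₀ + 1) z →
      |c₀| * (4 * d / (M₀ : ℝ)) * ∑ y ∈ (Sball e M₀ (M₀ + 1) z).filter (fun y => g.dist a y ≤ ρ), g.len y ≤
        |c₀| * (4 * d / (M₀ : ℝ)) * ((2 * ⌊ρ⌋₊ + 1 : ℝ) ^ d * ℓ) := by
  intro z a ha
  obtain ⟨x, rfl, -⟩ := exists_of_mem_Sball ha
  exact mul_le_mul_of_nonneg_left (localVol_le hiso hℓ hlenE hρ z x) (by positivity)

/-- **The binder `hV₂`** with `v₂ := θ₂·ℓ²`, θ₂ = c₀²·52d/M₀²: on the chart every length is ℓ. [cite: Balaban1985BackgroundPropagators, (3.89) p.409; Balaban1984PropagatorsII, (2.44) p.230] -/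
theorem hV₂_chart {e : UT N → g.Site} {ℓ : ℝ} (hlenE : ∀ x, g.len (e x) = ℓ) {M₀ : ℕ} (c₀ : ℝ) :
    ∀ (z : Ctr N M₀) (a : g.Site), a ∈ Sball e M₀ (M₀ + 1) z →
      c₀ ^ 2 * (52 * d / (M₀ : ℝ) ^ 2) * g.len a ^ 2 ≤ c₀ ^ 2 * (52 * d / (M₀ : ℝ) ^ 2) * ℓ ^ 2 := by
  intro z a ha
  rw [len_eq_of_mem_Sball hlenE ha]

end Binders

/-! ## §3  Print's «O(M⁻¹)», «O(M⁻²)» as numbers: the normalisation |c₀|·ℓ = η⁻¹·η = 1 -/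

section Explicit

/-- In print's normalisation (bond weight c₀ = η^{−1}, length ℓ = L^{j}η = η at j = 0, so |c₀|ℓ = 1) the volume
product v₁ IS 4d(2⌊ρ⌋+1)^d/M₀ — the «O(M^{−1})» of (3.89)/(2.44) with M ↔ M₀. [cite: Balaban1985BackgroundPropagators, (3.89) p.409; Balaban1984PropagatorsII, (2.44) p.230] -/
theorem v₁_explicit {c₀ ℓ : ℝ} (hn : |c₀| * ℓ = 1) (M₀ : ℕ) (ρ : ℝ) :
    |c₀| * (4 * d / (M₀ : ℝ)) * ((2 * ⌊ρ⌋₊ + 1 : ℝ) ^ d * ℓ) = 4 * d * (2 * ⌊ρ⌋₊ + 1 : ℝ) ^ d / M₀ := by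
  have : |c₀| * (4 * d / (M₀ : ℝ)) * ((2 * ⌊ρ⌋₊ + 1 : ℝ) ^ d * ℓ) =
      (|c₀| * ℓ) * (4 * d * (2 * ⌊ρ⌋₊ + 1 : ℝ) ^ d / M₀) := by ring
  rw [this, hn, one_mul]

/-- In the same normalisation v₂ IS 52d/M₀² — the «O(M^{−2})» size of Δh_□ times (L^{j}η)². [cite: Balaban1985BackgroundPropagators, (3.89) p.409; Balaban1984PropagatorsII, (2.44) p.230] -/
theorem v₂_explicit {c₀ ℓ : ℝ} (hn : |c₀| * ℓ = 1) (M₀ : ℕ) :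
    c₀ ^ 2 * (52 * d / (M₀ : ℝ) ^ 2) * ℓ ^ 2 = 52 * d / (M₀ : ℝ) ^ 2 := by
  have hsq : c₀ ^ 2 * ℓ ^ 2 = 1 := by
    have h := congrArg (fun t : ℝ => t ^ 2) hn
    simpa [mul_pow, sq_abs] using h
  have : c₀ ^ 2 * (52 * d / (M₀ : ℝ) ^ 2) * ℓ ^ 2 = (c₀ ^ 2 * ℓ ^ 2) * (52 * d / (M₀ : ℝ) ^ 2) := by ring
  rw [this, hsq, one_mul]

end Explicit

/-! ## §4  Entry 4 of (3.42) for G′ in the chart reading: the geometry binders discharged by name -/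

section Entry4

variable [∀ i, NeZero (N i)] [Fintype g.Site] [DecidableEq g.Site] {R : ℝ} {H : Prop} {Cp : Type}

/-- **Theorem 3.7 ⇒ entry 4 of (3.42) for G′ (Δ_UG′, weight 1) IN THE j = 0 CHART READING OF THE TORUS MODEL** =
`B9Thm37GluePU.thm37_entry4_torus` with `blk := cblk e`, `blkY := cblkY e`, `S_z := Sball e M₀ M₀ z`,
`S′_z := Sball e M₀ (M₀+1) z`, `N := 5^d`, `N′ := 7^d`, `v₁ := |c₀|(4d/M₀)·(2⌊ρ⌋+1)^d·ℓ`, `v₂ := c₀²(52d/M₀²)·ℓ²`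
and the binders `hS`, `hcnt`, `hcnt′`, `hsupp`, `hadj`, `hV₁`, `hV₂` DISCHARGED (§2), for an injective isometric
chart `e` with constant length ℓ ≥ 0 on its image and every ρ ≥ 1; the remaining hypotheses are carried verbatim
(NOT asserted: `hRm`, the ranges, the distance axioms of `g`, Lemma 2.1 of [4], the located smallness — now with
the explicit v₁, v₂, N′ —, the Q-data, Corollary 3.6 for the G′_□, `hloc`, `hinv`).  [cite: Balaban1985BackgroundPropagators, Thm 3.7 (3.87)–(3.90) pp.408–410 + (3.42) p.397 + (3.50) p.400; Balaban1984PropagatorsII, (2.36) p.229 + (2.40)–(2.44) p.230; Balaban1984PropagatorsI, (1.118) p.36] -/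
theorem thm37_entry4_chart [Fintype Cp] [DecidableEq Cp] {M₀ : ℕ} (hM : 1 ≤ M₀) (hdiv : ∀ i, M₀ ∣ N i)
    (h2N : ∀ i, 2 * M₀ ≤ N i) (c₀ : ℝ)
    (e : UT N → g.Site) (he : Function.Injective e) (hiso : ∀ x y : UT N, g.dist (e x) (e y) = dist x y)
    (ℓ : ℝ) (hℓ : 0 ≤ ℓ) (hlenE : ∀ x, g.len (e x) = ℓ)
    (Rm : UT N × Fin d → Cp → Cp → ℝ) (Qf : Module.End ℝ (UT N × Cp → ℝ)) (dd : ℕ) (δ₀ α ρ B₀ κQ : ℝ)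
    (KQ : Ctr N M₀ → g.Site → g.Site → ℝ) {G' : Module.End ℝ (UT N × Cp → ℝ)}
    (hRm : ∀ b i j, ∑ k, Rm b k i * Rm b k j = if i = j then 1 else 0)
    (hB₀ : 0 ≤ B₀) (hδ₀ : 0 ≤ δ₀) (hρ : 1 ≤ ρ) (hκQ : 0 ≤ κQ) (hαδ : 0 ≤ (1 - α) * δ₀)
    (htri : Triangle254 (toB6 g R H)) (hrefl : ∀ y : g.Site, g.dist y y = 0)
    (hdnn : ∀ y y' : g.Site, 0 ≤ g.dist y y') (hlen : ∀ y : g.Site, 0 ≤ g.len y)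
    (h261 : Ineq261 dd (toB6 g R H) δ₀ α) (h263 : Ineq263 dd (toB6 g R H) δ₀ α)
    (hsmall : (7 : ℝ) ^ d * (B₀ * Real.exp (δ₀ * ρ) *
        ((d + d * Fintype.card Cp : ℝ) * (|c₀| * (4 * d / (M₀ : ℝ)) * ((2 * ⌊ρ⌋₊ + 1 : ℝ) ^ d * ℓ)) +
          (c₀ ^ 2 * (52 * d / (M₀ : ℝ) ^ 2) * ℓ ^ 2 + κQ))) * B6.c1 dd δ₀ α < 1)
    (hKQ : ∀ i a b, 0 ≤ KQ i a b) (hlocQ : ∀ i a y'', KQ i a y'' ≠ 0 → g.dist a y'' ≤ ρ)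
    (hrowQ : ∀ i (a : g.Site), ∑ y'' : g.Site, KQ i a y'' * g.len y'' ^ 2 ≤
      if a ∈ Sball e M₀ (M₀ + 1) i then κQ else 0)
    {Gsq : Ctr N M₀ → Module.End ℝ (UT N × Cp → ℝ)}
    (h342_1 : ∀ i, HasMajorant (g := toB6 g R H) (cblk e) (Gsq i)
      (fun a b => B₀ * g.len a ^ 2 * Real.exp (-(δ₀ * g.dist a b))))
    (h342_2 : ∀ i, HasMajorantHom (g := toB6 g R H) (cblk e) (cblkY e)
      (covD bsrc btgt (fun _ : UT N × Fin d => c₀) Rm ∘ₗ Gsq i)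
      (fun a b => B₀ * g.len a * Real.exp (-(δ₀ * g.dist a b))))
    (h342_4 : ∀ i, HasMajorantHom (g := toB6 g R H) (cblk e) (cblk e)
      ((covDT bsrc btgt (fun _ : UT N × Fin d => c₀) Rm ∘ₗ covD bsrc btgt (fun _ : UT N × Fin d => c₀) Rm) ∘ₗ
        Gsq i)
      (fun a b => B₀ * Real.exp (-(δ₀ * g.dist a b))))
    (hQ : ∀ i, HasMajorant (g := toB6 g R H) (cblk e)
      (mulOp (hSU N M₀ i ∘ Prod.fst) * Qf - Qf * mulOp (hSU N M₀ i ∘ Prod.fst)) (KQ i))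
    (hloc : ∀ i, mulOp (hSU N M₀ i ∘ Prod.fst) *
      (covDT bsrc btgt (fun _ : UT N × Fin d => c₀) Rm ∘ₗ covD bsrc btgt (fun _ : UT N × Fin d => c₀) Rm + Qf) *
      Gsq i * mulOp (hSU N M₀ i ∘ Prod.fst) = mulOp (hSU N M₀ i ∘ Prod.fst) * mulOp (hSU N M₀ i ∘ Prod.fst))
    (hinv : G' * (covDT bsrc btgt (fun _ : UT N × Fin d => c₀) Rm ∘ₗ
      covD bsrc btgt (fun _ : UT N × Fin d => c₀) Rm + Qf) = 1) :
    HasMajorantHom (g := toB6 g R H) (cblk e) (cblk e)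
      ((covDT bsrc btgt (fun _ : UT N × Fin d => c₀) Rm ∘ₗ covD bsrc btgt (fun _ : UT N × Fin d => c₀) Rm) ∘ₗ G')
      (fun (a b : g.Site) => B₀ * ((5 : ℝ) ^ d + (7 : ℝ) ^ d * Real.exp (δ₀ * ρ) *
          ((d + d * Fintype.card Cp : ℝ) * (|c₀| * (4 * d / (M₀ : ℝ)) * ((2 * ⌊ρ⌋₊ + 1 : ℝ) ^ d * ℓ)) +
            c₀ ^ 2 * (52 * d / (M₀ : ℝ) ^ 2) * ℓ ^ 2)) *
        B6.c1 dd δ₀ α *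
        (1 - (7 : ℝ) ^ d * (B₀ * Real.exp (δ₀ * ρ) *
          ((d + d * Fintype.card Cp : ℝ) * (|c₀| * (4 * d / (M₀ : ℝ)) * ((2 * ⌊ρ⌋₊ + 1 : ℝ) ^ d * ℓ)) +
            (c₀ ^ 2 * (52 * d / (M₀ : ℝ) ^ 2) * ℓ ^ 2 + κQ))) * B6.c1 dd δ₀ α)⁻¹ *
        Real.exp (-((1 - α) * δ₀ * g.dist a b))) :=
  thm37_entry4_torus (Cp := Cp) hM hdiv h2N c₀ (cblk e) (cblkY e) Rm Qf dd δ₀ α ρ B₀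
    (|c₀| * (4 * d / (M₀ : ℝ)) * ((2 * ⌊ρ⌋₊ + 1 : ℝ) ^ d * ℓ)) (c₀ ^ 2 * (52 * d / (M₀ : ℝ) ^ 2) * ℓ ^ 2) κQ
    ((5 : ℝ) ^ d) ((7 : ℝ) ^ d) (Sball e M₀ M₀) (Sball e M₀ (M₀ + 1)) KQ
    hRm hB₀ hδ₀ (zero_le_one.trans hρ) (by positivity) (by positivity) hκQ (by positivity) (by positivity) hαδ
    htri hrefl hdnn hlen h261 h263 hsmall (hS_chart he hM) (hcnt_chart he hM) (hcnt'_chart he hM)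
    (hsupp_chart he hM) (hadj_chart hiso hρ) (hV₁_chart hiso hℓ hlenE (zero_le_one.trans hρ) c₀)
    (hV₂_chart hlenE c₀) hKQ hlocQ hrowQ h342_1 h342_2 h342_4 hQ hloc hinv

end Entry4

/-! ## §5  Non-vacuity of the chart hypotheses -/

/-- The chart hypotheses are satisfiable: for a geometry whose sites ARE the torus points with the torus distance
and a constant length, the identity chart is injective, isometric and of constant length. [folklore] -/
example (g : B9.Geometry) (hSite : g.Site = UT N) :
    ∃ e : UT N → g.Site, Function.Injective e :=
  ⟨fun x => cast hSite.symm x, fun x y h => by simpa using congrArg (cast hSite) h⟩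

/-- A concrete geometry carrying the identity chart: sites `UT N`, torus distance, scale 0, length η (all other
fields irrelevant to the (3.89)-glue and set to trivial data). The three chart hypotheses hold for `e := id`. [folklore] -/
example [∀ i, NeZero (N i)] (η L M : ℝ) :
    let g₀ : B9.Geometry :=
      { Site := UT N, scale := fun _ => 0, dist := fun x y => dist x y, k := 0, eta := η, L := L, M := M,
        Loc := Unit, suppIn := fun _ _ => True, suppInT := fun _ _ => True, supNorm := fun _ => 0,
        l2Norm := fun _ => 0, wNorm := fun _ _ => 0, holder := fun _ _ => 0, Cut := Unit,
        cutIn := fun _ _ => True, cutInT := fun _ _ => True, cutH := fun _ _ => 0, cutSup := fun _ => 0,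
        suppInT_of_suppIn := fun _ _ h => h, cutInT_of_cutIn := fun _ _ h => h }
    Function.Injective (id : UT N → g₀.Site) ∧ (∀ x y : UT N, g₀.dist (id x) (id y) = dist x y) ∧
      ∀ x : UT N, g₀.len (id x) = η := by
  refine ⟨fun x y h => h, fun x y => rfl, fun x => ?_⟩
  simp [B9.Geometry.len]

end

end Literature.MathematicalPhysics.QuantumFieldTheory.Balaban1983to89.B9Thm37GlueChart
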